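import Summits.CriticalPhenomena.PercolationContinuityZ3.Theorems.Transplant.SkelSign2ParamsWidths
import Summits.CriticalPhenomena.PercolationContinuityZ3.Theorems.Transplant.SkelSign2ParamsAtQ2
import Summits.CriticalPhenomena.PercolationContinuityZ3.Theorems.Transplant.SkelSign2ParamsDepth
import Summits.CriticalPhenomena.PercolationContinuityZ3.Theorems.Transplant.SkelSign2ParamsCounts
import Summits.CriticalPhenomena.PercolationContinuityZ3.Theorems.Transplant.KNCells2ChainFaceRunRO
import Summits.CriticalPhenomena.PercolationContinuityZ3.Theorems.Transplant.PlanarCells2FaceRun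
import HarnessLib

/-!
# D″ L7′ params, part 14a: UNPACKING `signChoice₂` FOR THE FACE RESIDUE (F) — the (F) VALUES and the facts of binder groups (a) (b) (d) (e) and the
# first hop of (f) that hp-8 g30's `Skelφ.faceOblR_concS_kits` consumes (SIGN-PARAMS.md §9 (F)), under `hat : (Sgn₂.choiceAt κ Φ t p hC).AtQ O q`;
# part 14b (`SkelSign2ParamsFace`, which imports this file) carries the two-band admissibility, the fits, the reach and the inner route (f)/(g).

builds on p205010 (kernel theorem, internal audit signed; external expert review pending) — nothing in this file uses p205010.
Status sentence (coordinator 2026-08-20T04:30Z): "θ(p_c) = 0 on ℤ^d, all d ≥ 2 — kernel-verified (Lean 4/Mathlib, standard axioms); internal adversarial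
audit SIGNED 2026-08-20 04:29Z; external expert review pending."
Lane `prim-bschramm-*`, seat `prim-bschramm-stmt` (gen 9); helper file (`--supports stmt-CriticalPhenomena-4575`).
VALUES ((F) schedule of record per axis `i`, all `Sgn₂.*`/`Sgn.*`): face-step window `[T₀, Rlev]` (`M := T₀ − 1`), count `NP`, kit number `kP` at accuracy
`κ.δ₂`; excess radius `R₁ ρ := Rex q (ρ+1)`; inner accuracy `δA := δkit`, `ηA := η = δkit/2`; inner window depth `Lin := L′ − ψMz`, kit reach `L″ := L′`,
`Lr := r₀`, inner excess radius `R₁A := Rex q (2ψMz)`; first hop `ℓ1`, `a₁ i := widths i (ℓ1 i)`; prefix band: `q′₁ := qR′` (spread at `ℓ1`), stride `e i`,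
`N₁ := L − 1` short strides, `WM₁ := WMR`, `ρ₁ := ρ₁N`; long band: stride `sL i = L e − R′`, count `N₂F i lv := N₂of sL (clamp (17 r − lv − ℓ1 − L e))`,
cap `NcapF := N₂of sL (17 r)`, `WM₂ := WMC`, `ρ₂ := ρ₂N`; spreads `Wb := WbR`; extents `ℓ₀`, `e + R′`, `ℓtop`.
FACTS (this file): `face_levels_at`, `face_count_at`, `face_rows_at` ((a)/(d)); `face_acc_at` ((b)); `face_gap_at` ((a) `hgap hgap20 hgapR hgap₀`, `hE₀ hL'`);
`face_rim_at` ((e)); `face_first_at` ((f) `hka hkR hRtL hq'a hMzℓ1`); `face_units_at` (the (F) units in `ℕ`), `cast_L_pred`.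
[cite: KozmaNitzan2024, §4 pp. 26–31 (Step III), Lemma 11 (pp. 22–23), Lemma 12 (pp. 23–25)]
-/

noncomputable section

open MeasureTheory
open scoped Classical

namespace Summit.CriticalPhenomena.PercolationContinuityZ3.Theorems.Transplant

namespace PlanarSkeletonSign

namespace Sgn₂

open Literature.Probability.Percolation Literature.Probability.LatticeModels SimpleGraph
open Literature.Probability.Percolation.KozmaNitzan.Cells (oth oth_oth)
open Literature.Barriers.CriticalPhenomena (graphBall graphBall_mono)
open SkelConc (Consts)
open Sgn (K a A L twenty_le_K one_le_a hundred_le_A K_le_A five_le_L sixteen_L_le_A δkit δI m₀ Mu ρz M T₀ Kd Rseed rs cU sB B kP NP Lcnt Rlev R' η reachK Sz L_hyps)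
open SkelI (tanOff)
open ChainPlanar
open Skel (excess)

section Defs

variable (κ : Consts) {V : Type} [DecidableEq V] [Countable V] {G : SimpleGraph V} [G.LocallyFinite] (Φ : PlanarSkeletonSign G)
  (p : unitInterval) (O : Skelφ.StepI.Out V)

/-! ## §1 The (F) values -/

/-- The prefix band's transverse room `ρ₁N := qR′ + L·R′ + 2·WMR` (= `q′₁ + (N₁+1)R′ + 2WM₁` with `N₁ = L − 1`). [this work] -/
def ρ₁N (i : Fin 2) : ℕ := qR' κ Φ p O i + L κ * R' κ Φ p O + 2 * WMR κ Φ p O i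

/-- The long band's step-count cap `NcapF := N₂of sL (17 r)`. [this work] -/
def NcapF (i : Fin 2) : ℕ := FaceRun.N₂of (sL κ Φ p O i : ℤ) (17 * ((cells κ Φ p O).r i : ℤ))

/-- The level deficit of the long band to the target's near face: `XF i lv := 17 r − lv − ℓ1 − L·e`. [this work] -/
def XF (i : Fin 2) (lv : ℤ) : ℤ := 17 * ((cells κ Φ p O).r i : ℤ) - lv - ℓ1 κ Φ p O i - L κ * e κ Φ p O i

/-- **The long band's step count** `N₂F i lv := N₂of sL (max 0 (min (XF i lv) (17 r)))` (the clamp makes it `≤ NcapF` for EVERY `lv`; on the face rows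
it is `N₂of sL (XF i lv)`). [this work] -/
def N₂F (i : Fin 2) (lv : ℤ) : ℕ := FaceRun.N₂of (sL κ Φ p O i : ℤ) (max 0 (min (XF κ Φ p O i lv) (17 * ((cells κ Φ p O).r i : ℤ))))

/-- The long band's transverse room `ρ₂N := qR′ + R′ + WMR + (L−1)R′ + (NcapF+1)R′ + 2·WMC`. [this work] -/
def ρ₂N (i : Fin 2) : ℕ :=
  qR' κ Φ p O i + R' κ Φ p O + WMR κ Φ p O i + (L κ - 1) * R' κ Φ p O + (NcapF κ Φ p O i + 1) * R' κ Φ p O + 2 * WMC κ Φ p O i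

/-- **The inner window depth** `Lin := L′ − ψMz` (about every deep contact; the kit reach is `L″ := L′`). [this work] -/
def Lin (q : unitInterval) : ℕ := Skelφ.Prm.Lp (schedIn κ Φ p O q) - ψMz O

/-- **The inner excess radius** `R₁A := Rex q (2ψMz)` (entrances as deep as the wired seed, `ψ(D.k) + off ≤ ρz ≤ 2ψMz`). [this work] -/
def R₁A (q : unitInterval) : ℕ := Rex κ Φ p O q (2 * ψMz O)

end Defs

section AtQ

variable {κ : Consts} {V : Type} [DecidableEq V] [Countable V] {G : SimpleGraph V} [G.LocallyFinite] {Φ : PlanarSkeletonSign G}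
  {t : V} {p : unitInterval} {hC : Φ.CylSubcritical p} {O : Skelφ.StepI.Out V} {q : unitInterval}
  (hat : (choiceAt κ Φ t p hC).AtQ O q)
include hat

/-! ## §2 (a)/(d): the face step's window, count, rows; (b): accuracies; the gaps -/

omit hat in
/-- **Window levels** `[M+1, Rlev]` with `M := T₀ − 1`: `tanOff M M ≤ (T₀ − 1) + 1` (`hMt`), `#Icc ((T₀−1)+1) Rlev = Lcnt + 1`, `Rlev + 1 ≤ R′`, `T₀ − 1 + 1 = T₀`.
[folklore] -/
theorem face_levels_at : tanOff (M O) (M O) ≤ T₀ O - 1 + 1 ∧ (Finset.Icc (T₀ O - 1 + 1) (Rlev κ Φ p O)).card = Lcnt κ Φ p O + 1 ∧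
    Rlev κ Φ p O + 1 ≤ R' κ Φ p O ∧ T₀ O - 1 + 1 = T₀ O := by
  have hT : T₀ O = 3 * M O + 2 := by unfold T₀ tanOff; omega
  have h1 : T₀ O - 1 + 1 = T₀ O := by omega
  refine ⟨by rw [h1]; exact le_of_eq rfl, ?_, le_of_eq rfl, h1⟩
  rw [h1, Nat.card_Icc]; unfold Rlev; omega

/-- **The face step's count and kit number at accuracy `δ₂`** and the inner chain's at `δkit`: `1/(1−q)^{Δ·NP} ≤ δ₂·#Icc (M+1) Rlev`, `(1 − q^{sB})^{kP} ≤ δ₂`,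
`kP·B ≤ NP`; `1/(1−q)^{Δ·NP} ≤ δkit·#Icc T₀ Rlev`, `(1 − q^{sB})^{kP} ≤ δkit`. [folklore] -/
theorem face_count_at (hp0 : 0 < (p : ℝ)) (hp1 : (p : ℝ) < 1) :
    1 / (1 - (q : ℝ)) ^ (Φ.Δ * NP κ Φ p O) ≤ κ.δ₂ * ((Finset.Icc (T₀ O - 1 + 1) (Rlev κ Φ p O)).card : ℝ) ∧
    (1 - (q : ℝ) ^ sB Φ O) ^ kP κ Φ p O ≤ κ.δ₂ ∧ kP κ Φ p O * B Φ O ≤ NP κ Φ p O ∧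
    1 / (1 - (q : ℝ)) ^ (Φ.Δ * NP κ Φ p O) ≤ δkit κ Φ * ((Finset.Icc (T₀ O) (Rlev κ Φ p O)).card : ℝ) ∧
    (1 - (q : ℝ) ^ sB Φ O) ^ kP κ Φ p O ≤ δkit κ Φ := by
  have hl := face_levels_at (κ := κ) (Φ := Φ) (p := p) (O := O)
  have h₂ := counts_at_le hat hp0 hp1 (δkit_facts κ Φ).2.2.2.1
  have h₀ := counts_at hat hp0 hp1
  have hc : (Finset.Icc (T₀ O) (Rlev κ Φ p O)).card = Lcnt κ Φ p O + 1 := by rw [← hl.2.2.2]; exact hl.2.1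
  refine ⟨?_, h₂.1, (hN hp0 hp1).1, ?_, h₀.1⟩
  · rw [hl.2.1]; exact h₂.2 _ (Nat.le_succ _)
  · rw [hc]; exact h₀.2 _ (Nat.le_succ _)

/-- **Face rows**: `Rlev + 4 ≤ 10·s_i` and `Rlev + 3 ≤ 3·r_i` (both axes). [folklore] -/
theorem face_rows_at (i : Fin 2) : Rlev κ Φ p O + 4 ≤ 10 * (cells κ Φ p O).s i ∧ Rlev κ Φ p O + 3 ≤ 3 * (cells κ Φ p O).r i := by
  have hu := units_large_at hat i
  have hs := cells_s_at hat i
  have hr := cells_r_at hat i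
  have ha := one_le_a κ
  have hA := hundred_le_A κ
  have hR : R' κ Φ p O = Rlev κ Φ p O + 1 := rfl
  have he : e κ Φ p O i ≤ (cells κ Φ p O).s i := by rw [hs]; exact Nat.le_mul_of_pos_left _ ha
  have he' : e κ Φ p O i ≤ (cells κ Φ p O).r i := (e_le_r_at hat i).1
  have h40 : 40 * R' κ Φ p O ≤ e κ Φ p O i := le_trans (by nlinarith) hu.1
  constructor <;> omega

omit hat in
/-- **Accuracies** ((b)): `0 < δ₂`, `0 < δkit`, `δI ≤ δ₂²`, `δI ≤ δkit`, `δI ≤ δkit²`, `η ≤ δ/2`, `η ≤ δkit/2`. [folklore] -/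
theorem face_acc_at : 0 < κ.δ₂ ∧ 0 < δkit κ Φ ∧ δI κ Φ ≤ κ.δ₂ ^ 2 ∧ δI κ Φ ≤ δkit κ Φ ∧ δI κ Φ ≤ δkit κ Φ ^ 2 ∧ η κ Φ ≤ κ.δ / 2 ∧
    η κ Φ ≤ δkit κ Φ / 2 := by
  have hk := δkit_facts κ Φ
  have hI := δI_facts κ Φ
  have hη := η_facts κ Φ
  refine ⟨κ.hδ₂0, hk.1, hI.2.1.trans (pow_le_pow_left₀ hk.1.le hk.2.2.2.1 2), ?_, hI.2.1, hη.2.2.1, le_of_eq hη.2.1⟩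
  calc δI κ Φ ≤ δkit κ Φ ^ 2 := hI.2.1
    _ ≤ δkit κ Φ := by nlinarith [hk.1, hk.2.1]

/-- **Gaps** ((a) `hgap hgap20 hgapR`, (d) `hgap₀`) and `2 ≤ E₀`, `1 ≤ L′`: `1 ≤ gap ρ`, `20 rmax ≤ gap ρ`, `20 rmax + 2L′ + Rex q (ρ+1) ≤ gap ρ`, `r₀ + 1 ≤ gap ρ`.
[folklore] -/
theorem face_gap_at (ρ : ℕ) : 1 ≤ Skelφ.Prm.gap (schedIn κ Φ p O q) ρ ∧ 20 * (cells κ Φ p O).rmax ≤ Skelφ.Prm.gap (schedIn κ Φ p O q) ρ ∧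
    20 * (cells κ Φ p O).rmax + 2 * Skelφ.Prm.Lp (schedIn κ Φ p O q) + Rex κ Φ p O q (ρ + 1) ≤ Skelφ.Prm.gap (schedIn κ Φ p O q) ρ ∧
    r₀ κ Φ p O + 1 ≤ Skelφ.Prm.gap (schedIn κ Φ p O q) ρ ∧ 2 ≤ Skelφ.Prm.E₀ (schedIn κ Φ p O q) ∧ 1 ≤ Skelφ.Prm.Lp (schedIn κ Φ p O q) := by
  have hg : Skelφ.Prm.gap (schedIn κ Φ p O q) ρ = 2 * Skelφ.Prm.Lp (schedIn κ Φ p O q) + 1 + Rex κ Φ p O q (ρ + 1) + 100 * (cells κ Φ p O).rmax :=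
    Skelφ.Prm.gap_eq (schedIn κ Φ p O q) ρ
  have h := fibre_at (κ := κ) (Φ := Φ) (p := p) (O := O) (q := q) ρ 0
  have hr := (r_le_rmax_at hat 0).2
  exact ⟨h.2.2.2.1, h.2.2.1, by rw [hg]; omega, (r₀_le_E₀_gap hat ρ).2, Skelφ.Prm.two_le_E₀ _, Skelφ.Prm.one_le_Lp _⟩

/-! ## §3 (e): rim numerics — the inner window depth `Lin = L′ − ψMz` -/

/-- **Rim numerics**: `ψMz ≤ L′`, `Lin + ψMz = L′`, `L_A ≤ Lin`, `24 rmax ≤ Lin`, `Lin + Rk i ≤ L′` (`hLRk`, with `L″ := L′`), `r₀ ≤ L′`, `r₀ ≤ Lin` (`hr₀L`),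
`r₀ + R₁A ≤ Lin` (`hRA` with `Lr := r₀`). [folklore] -/
theorem face_rim_at (i : Fin 2) : ψMz O ≤ Skelφ.Prm.Lp (schedIn κ Φ p O q) ∧ Lin κ Φ p O q + ψMz O = Skelφ.Prm.Lp (schedIn κ Φ p O q) ∧
    Skelφ.Prm.LA (schedIn κ Φ p O q) ≤ Lin κ Φ p O q ∧ 24 * (cells κ Φ p O).rmax ≤ Lin κ Φ p O q ∧
    Lin κ Φ p O q + Skelφ.Prm.Rk O.D (Mu O) i ≤ Skelφ.Prm.Lp (schedIn κ Φ p O q) ∧ r₀ κ Φ p O ≤ Skelφ.Prm.Lp (schedIn κ Φ p O q) ∧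
    r₀ κ Φ p O ≤ Lin κ Φ p O q ∧ r₀ κ Φ p O + R₁A κ Φ p O q ≤ Lin κ Φ p O q := by
  have hψ : O.D.R = Skelφ.fatRadius Φ.frame hC := (R_Λ_eq hat).1
  have hmono : Monotone O.D.R := by rw [hψ]; exact Skelφ.fatRadius_mono Φ.frame hC
  have hLp : Skelφ.Prm.Lp (schedIn κ Φ p O q) = Skelφ.Prm.LA (schedIn κ Φ p O q) + O.D.R (topScale κ Φ p O) + ψMz O +
      12 * topScale κ Φ p O + 2 * M O + reachK Φ O := rfl
  have hLA := Skelφ.Prm.planar_le_LA (schedIn κ Φ p O q)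
  have hRex : R₁A κ Φ p O q ≤ Skelφ.Prm.LA (schedIn κ Φ p O q) := (Rex_seed_le_LA (κ := κ) (Φ := Φ) (p := p) (O := O) (q := q)).1
  -- `Rk i = ψ(amax (A i)) ≤ ψ M ≤ ψMz`
  have hRk : Skelφ.Prm.Rk O.D (Mu O) i ≤ ψMz O := by
    have h1 : Skelφ.amax (Skelφ.Prm.A O.D (Mu O) i) ≤ M O :=
      max_le (Skelφ.Prm.hA O.D (Mu O) i 0) (Skelφ.Prm.hA O.D (Mu O) i 1)
    exact (hmono h1).trans (le_max_left _ _)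
  -- `r₀ + ψMz + L_A ≤ L′`: `r₀ = rs + 6M + 4 + ψtop`, `rs ≤ reachK`, `4M + 4 ≤ 12·topScale`
  have hrk : rs Φ O ≤ reachK Φ O := by unfold reachK; omega
  have hM : M O ≤ topScale κ Φ p O := by
    have h1 : Mu O + 1 ≤ M O := Skelφ.Prm.Mu_succ_le_M O.D (Mu O)
    have h2 : M O ≤ e κ Φ p O 0 := by have := (units_large_at hat 0).2.2.1; have := hundred_le_A κ; nlinarith
    have h3 : e κ Φ p O 0 ≤ Smax κ Φ p O := (extents_le_at hat 0).2.1.trans (((extents_le_at hat 0).2.2.1).trans (Smin_Smax_at hat 0).2.1)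
    unfold topScale; omega
  have hM1 : 1 ≤ M O := Skelφ.Prm.one_le_M O.D (Mu O)
  have hr₀ : r₀ κ Φ p O + ψMz O + Skelφ.Prm.LA (schedIn κ Φ p O q) ≤ Skelφ.Prm.Lp (schedIn κ Φ p O q) := by
    rw [hLp]; unfold r₀; omega
  have hrm : (schedIn κ Φ p O q).rmax = (cells κ Φ p O).rmax := rfl
  rw [hrm] at hLA
  unfold Lin
  refine ⟨by omega, by omega, by omega, by omega, by omega, by omega, by omega, by omega⟩

/-! ## §4 (f): the first hop -/

/-- Every half-width of a band rectangle of extent `ℓ ≥ D.k` is `≥ D.k` (the 7th Step-I′ fact `D.k ≤ Gb ℓ, Fb ℓ`). [folklore] -/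
theorem k_le_widths_at (i i' : Fin 2) {ℓ : ℕ} (hk : O.D.k ≤ ℓ) : O.D.k ≤ Skelφ.StepI.widths O.D.Gb O.D.Fb i ℓ i' := by
  have hkℓ := (k_lt hat).2.2 ℓ
  fin_cases i <;> fin_cases i' <;> simp [Skelφ.StepI.widths] <;> omega

/-- **The first hop** `ℓ1`, `a₁ i := widths i (ℓ1 i)`: `ℓ1 0 ∈ Sx`, `ℓ1 1 ∈ Sy`; `hka : D.k ≤ a₁ i i'`; **`hkR : ψ(D.k) + off ≤ ψ(amax (a₁ i))`** (the corrected
floor: `ρz ≤ e ≤ ℓ1 ≤ amax ≤ ψ amax`); `hRtL : ψ(amax (a₁ i)) ≤ Lin`; `hq'a : a₁ i (oth i) ≤ qR′ i` (equality); `hMzℓ1 : Mu + e + 2R′ < ℓ1`. [folklore] -/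
theorem face_first_at (i : Fin 2) : ℓ1 κ Φ p O 0 ∈ Sx κ Φ p O ∧ ℓ1 κ Φ p O 1 ∈ Sy κ Φ p O ∧
    (∀ i', O.D.k ≤ Skelφ.StepI.widths O.D.Gb O.D.Fb i (ℓ1 κ Φ p O i) i') ∧
    Skelφ.fatRadius Φ.frame hC O.D.k + O.off ≤ O.D.R (Skelφ.amax (Skelφ.StepI.widths O.D.Gb O.D.Fb i (ℓ1 κ Φ p O i))) ∧
    O.D.R (Skelφ.amax (Skelφ.StepI.widths O.D.Gb O.D.Fb i (ℓ1 κ Φ p O i))) ≤ Lin κ Φ p O q ∧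
    (Skelφ.StepI.widths O.D.Gb O.D.Fb i (ℓ1 κ Φ p O i) (oth i) : ℤ) ≤ (qR' κ Φ p O i : ℤ) ∧
    (Mu O : ℤ) + e κ Φ p O i + 2 * R' κ Φ p O < ℓ1 κ Φ p O i := by
  have hm := mem_lists_at (κ := κ) (Φ := Φ) (p := p) (O := O)
  have hψ : O.D.R = Skelφ.fatRadius Φ.frame hC := (R_Λ_eq hat).1
  have hmono : Monotone O.D.R := by rw [hψ]; exact Skelφ.fatRadius_mono Φ.frame hC
  have hb := extents_le_at hat i
  have hS := Smin_Smax_at hat i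
  have hk1 : O.D.k ≤ ℓ1 κ Φ p O i := (Mu_succ_le_ℓ₀_at hat i).2.trans (hb.1.trans hb.2.1)
  have hρ := (ρz_le_e_at hat i).2.1
  refine ⟨hm.2.2.2.1, hm.2.2.2.2, fun i' => k_le_widths_at hat i i' hk1, ?_, ?_, le_of_eq rfl,
    by have := (extents_eq_at hat i).2.1; omega⟩
  · -- `ψ(D.k) + off ≤ e ≤ ℓ1 ≤ amax ≤ ψ(amax)`
    have h1 : ℓ1 κ Φ p O i ≤ Skelφ.amax (Skelφ.StepI.widths O.D.Gb O.D.Fb i (ℓ1 κ Φ p O i)) := Skelφ.StepI.le_amax_widths _ _ i _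
    have h2 := Skelφ.le_fatRadius Φ.frame hC (Skelφ.amax (Skelφ.StepI.widths O.D.Gb O.D.Fb i (ℓ1 κ Φ p O i)))
    rw [hψ] at hρ ⊢; omega
  · have h := hmono (amax_widths_le_topScale hat i hk1 (hb.2.2.1.trans hS.2.1))
    have hr := face_rim_at hat i
    have : O.D.R (topScale κ Φ p O) ≤ Skelφ.Prm.LA (schedIn κ Φ p O q) := by
      show (schedIn κ Φ p O q).ψtop ≤ _; unfold Skelφ.Prm.LA; omega
    omega

/-! ## §5 (f): the (F) units in `ℕ` (the two bands, fits and reach that use them are in part 14b `SkelSign2ParamsFace`) -/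

/-- The (F) units in `ℕ`: `R′ + ℓ₀ ≤ e`, `2R′ ≤ e`, `R′ + ℓ₀ ≤ sL`, `2R′ ≤ sL`, `sL + R′ = ℓtop`, `4e ≤ sL`, `sL ≤ r`, `ℓtop + e ≤ r`, `NcapF·sL ≤ 17 r`,
`NcapF + 1 ≤ 5A`, `∀ lv, N₂F lv ≤ NcapF`, `40·(A·R′) ≤ e` (both axes), `L·R′ ≤ A·R′`, `0 < sL`. [folklore] -/
theorem face_units_at (i : Fin 2) : R' κ Φ p O + ℓ₀ κ Φ p O i ≤ e κ Φ p O i ∧ 2 * R' κ Φ p O ≤ e κ Φ p O i ∧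
    R' κ Φ p O + ℓ₀ κ Φ p O i ≤ sL κ Φ p O i ∧ 2 * R' κ Φ p O ≤ sL κ Φ p O i ∧ sL κ Φ p O i + R' κ Φ p O = ℓtop κ Φ p O i ∧
    4 * e κ Φ p O i ≤ sL κ Φ p O i ∧ sL κ Φ p O i ≤ (cells κ Φ p O).r i ∧ ℓtop κ Φ p O i + e κ Φ p O i ≤ (cells κ Φ p O).r i ∧
    NcapF κ Φ p O i * sL κ Φ p O i ≤ 17 * (cells κ Φ p O).r i ∧ NcapF κ Φ p O i + 1 ≤ 5 * A κ ∧
    (∀ lv, N₂F κ Φ p O i lv ≤ NcapF κ Φ p O i) ∧ 40 * (A κ * R' κ Φ p O) ≤ e κ Φ p O i ∧ 40 * (A κ * R' κ Φ p O) ≤ e κ Φ p O (oth i) ∧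
    L κ * R' κ Φ p O ≤ A κ * R' κ Φ p O ∧ 0 < sL κ Φ p O i := by
  obtain ⟨hS, hSL, -, h1, h2, -, h3, h4', -⟩ := strides_at hat i
  have hu := (units_large_at hat i).1
  have huo := (units_large_at hat (oth i)).1
  rw [Nat.mul_assoc] at hu huo
  have hr := cells_r_at hat i
  have hA := hundred_le_A κ
  have hL5 := five_le_L κ
  have hLA' : L κ + 1 ≤ A κ := by have := (sixteen_L_le_A κ).2; omega
  have hLA : L κ ≤ A κ := by omega
  have he := one_le_e_at hat i
  have ht : ℓtop κ Φ p O i = L κ * e κ Φ p O i := rfl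
  have hsS : sS κ Φ p O i = e κ Φ p O i := rfl
  rw [hsS] at h1 h3
  -- `4e ≤ sL`: `sL + R′ = L e ≥ 5 e` and `R′ ≤ e`
  have h5e : 5 * e κ Φ p O i ≤ L κ * e κ Φ p O i := Nat.mul_le_mul_right _ hL5
  have h4 : 4 * e κ Φ p O i ≤ sL κ Φ p O i := by omega
  -- `ℓtop + e = (L+1) e ≤ A e = r`
  have hte : ℓtop κ Φ p O i + e κ Φ p O i ≤ (cells κ Φ p O).r i := by
    have := Nat.mul_le_mul_right (e κ Φ p O i) hLA'
    rw [hr, ht]; simpa [Nat.add_mul] using this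
  have hsLr : sL κ Φ p O i ≤ (cells κ Φ p O).r i := by omega
  have hpos : 0 < sL κ Φ p O i := by omega
  -- the cap: `NcapF·sL ≤ 17 r` (floor), hence `4·NcapF ≤ 17 A`
  have hcap : NcapF κ Φ p O i * sL κ Φ p O i ≤ 17 * (cells κ Φ p O).r i := by
    have h := (FaceRun.N₂of_spec (s₂ := (sL κ Φ p O i : ℤ)) (X := 17 * ((cells κ Φ p O).r i : ℤ)) (by exact_mod_cast hpos) (by positivity)).2
    unfold NcapF; exact_mod_cast h
  have hcapA : NcapF κ Φ p O i + 1 ≤ 5 * A κ := by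
    have h' : NcapF κ Φ p O i * (4 * e κ Φ p O i) ≤ 17 * A κ * e κ Φ p O i := by
      calc NcapF κ Φ p O i * (4 * e κ Φ p O i) ≤ NcapF κ Φ p O i * sL κ Φ p O i := Nat.mul_le_mul_left _ h4
        _ ≤ 17 * (cells κ Φ p O).r i := hcap
        _ = 17 * A κ * e κ Φ p O i := by rw [hr, Nat.mul_assoc]
    have h'' : NcapF κ Φ p O i * 4 * e κ Φ p O i ≤ 17 * A κ * e κ Φ p O i := by simpa [Nat.mul_assoc] using h'
    have := Nat.le_of_mul_le_mul_right h'' he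
    omega
  have hmono : ∀ lv, N₂F κ Φ p O i lv ≤ NcapF κ Φ p O i := fun lv => by
    unfold N₂F NcapF FaceRun.N₂of
    exact Int.toNat_le_toNat (Int.ediv_le_ediv (by exact_mod_cast hpos) (max_le (by positivity) (min_le_right _ _)))
  exact ⟨h1, h3, h2, h4', hSL, h4, hsLr, hte, hcap, hcapA, hmono, hu, huo, Nat.mul_le_mul_right _ hLA, hpos⟩

omit hat in
/-- `((L − 1 : ℕ) : ℤ) + 1 = L` (`L ≥ 5`). [folklore] -/
theorem cast_L_pred : ((L κ - 1 : ℕ) : ℤ) + 1 = (L κ : ℤ) := by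
  have h := Nat.sub_add_cancel (le_trans (by norm_num) (five_le_L κ) : 1 ≤ L κ)
  exact_mod_cast h

end AtQ

end Sgn₂

end PlanarSkeletonSign

end Summit.CriticalPhenomena.PercolationContinuityZ3.Theorems.Transplant

end
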